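import Summits.QuantumFields.YangMills.Theorems.BalabanLadderNTMarkovMirrorBare
import Summits.QuantumFields.YangMills.Theorems.BalabanLadderNTMarkovMirrorDefectFBL6
import Summits.QuantumFields.YangMills.Theorems.BalabanLadderUVSeamRecFloorsEngineOfReference
import HarnessLib

/-!
# Crux `UVSeamRec` (stmt-QuantumFields-20043), stub `stub_floorsEngine` (v4-F, S-B): CHECK-LEMMA — the registered
# statement from the Markov–mirror line WITHOUT shell data: {BL6, bare mirror floor} at `rF`

Helper file (`--supports stmt-QuantumFields-20043`) of the seam stub-prover row `ym-20043-seam-s1` (owner RULING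
R75; director LINE №111/№113).  It is the specialisation «last file» of `…NTMarkovMirrorBare` (general `(G, r, a)`)
to `(SU(2), rF = fundamentalLatticeRep 2, a/uRec → c₀)`, parallel to p512282
`MarkovMirrorFloors.stubFloorsEngine_of_mirrorPackage_rF`, whose hypothesis carried per coupling the shell data
`(p β, 𝒢_β)` with (RBL+SUP) and (SF).  By `MarkovMirror.mirrorPackage_of_bareFloor` those data can always be taken
canonical (`p := 0`, `𝒢_β := −kerE_{Q_β}(Ṽ_v)`, (RBL+SUP) with error `0`), so the package hypothesis of p512282 is
implied by — and, through `MarkovMirror.mirrorCov_ge_of_boundaryResponse` (p507216), implies up to the constant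
`4 ↔ 9/4` — the package WITHOUT shell data:

* unit clauses `0 < a`, `a β / uRec β → c₀ > 0`;
* ONE compactly supported positive-time `v`, `ε > 0`, `κ > 0`, `C₁ ≥ 0`; per coupling ONE positive-time femto cube
  `Q_β = (c β, b β)` of physical size `≤ Λ₅` carrying the lattice support of `v(aβ·)` at depth `≥ 2` and its
  `e₀`-thickening at physical depth `≥ κ`;
* (BL6) `|kerE_{Q_β}^ζ(plane_q x) − p_q β| ≤ C₁/depth(x)⁴` for every exterior `ζ`, electric `q`, `x` in the
  thickened support (⇐ `FBL6 SU(2) rF a`);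
* (MF)  `4ε ≤ Cov_T(Ṽ_v∘Θ₀, Ṽ_v)` on every torus `aβ·L ≥ Λ₅`, `Ṽ_v = ∑_{y ∈ Q_β} v(aβ·y) dens_y` — the bare
  lattice mirror floor of the smeared action density carried by `Q_β`;
* any supplier of the compact-witness three-point conjunct.

`stubFloorsEngine_of_bareFloor_rF` then concludes the REGISTERED v4-F `stub_floorsEngine` statement verbatim
(`Cruxes/UVSeamRec/Lines/birth.lean` f523973980851859: `Transport.uRec`, `fundamentalLatticeRep 2`).
`stubFloorsEngine_of_bareFloorΔ_rF` is the same with (RBLΔ) assumed directly instead of (BL6).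
Located reading for the owner's pen (no registry content): in the Markov–mirror currency the clause-(i) input of
(S-B) is {BL6, MF}; the one-point data (RBL+SUP, SF) of card E add a PROOF STRATEGY (pin `𝒢` to the classical
Dirichlet-excess functional and prove RBL semiclassically), not a weaker target.  Nothing here is `SU(2)`-specific
beyond the instantiation; no `UV`, no two-point ceiling, no window is consumed.  Honest status: MF, BL6/FBL6 and
clause (ii) are engine-grade (crux `NT`); this file is bookkeeping.
-/

set_option autoImplicit false

noncomputable section

open scoped SchwartzMap
open MeasureTheory Filter Topology
open Literature.MathematicalPhysics.QuantumFieldTheory Literature.MathematicalPhysics.QuantumLattice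
open Literature.Probability.LatticeModels
open Summit.QuantumFields.YangMills.Cruxes.OSLegsFromFemtoAndGap.DlrCollarTransfer
open Summit.QuantumFields.YangMills.Cruxes.NT.MarkovMirror

namespace Summit.QuantumFields.YangMills.Cruxes.UVSeamRec.MarkovMirrorFloors

/-- **CHECK-LEMMA (RBLΔ form): the REGISTERED v4-F `stub_floorsEngine` statement from {RBLΔ, MF} at `rF`.**
For `SU(2)` with its Borel σ-algebra: a unit map `a > 0` with `a β / uRec β → c₀ > 0`; ONE compactly supported
positive-time `v`, `ε > 0`; per coupling a positive-time cube `Q_β` of physical size `≤ Λ₅` carrying the lattice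
support of `v(aβ·)` at depth `≥ 2`; (RBLΔ) the chirality-defect boundary response is within `√ε/2` of a constant
`p' β` for every exterior; (MF) `4ε ≤ Cov_T(Ṽ_v∘Θ₀, Ṽ_v)` on every torus `aβ·L ≥ Λ₅`; any supplier of the
three-point conjunct.  Then the statement of `stub_floorsEngine` holds. [folklore] -/
theorem stubFloorsEngine_of_bareFloorΔ_rF
    (h : letI : MeasurableSpace (Matrix.specialUnitaryGroup (Fin 2) ℂ) := borel _
      haveI : BorelSpace (Matrix.specialUnitaryGroup (Fin 2) ℂ) := ⟨rfl⟩
      ∃ (a : ℝ → ℝ) (c₀ : ℝ), 0 < c₀ ∧ (∀ β, 0 < a β) ∧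
        Tendsto (fun β => a β / Transport.uRec β) atTop (𝓝 c₀) ∧
      (∃ (v : 𝓢(EuclideanSpace ℝ (Fin 4), ℝ)) (ε β₅ Λ₅ : ℝ) (c : ℝ → (Fin 4 → ℤ)) (b : ℝ → ℕ) (p' : ℝ → ℝ),
          HasCompactSupport (v : EuclideanSpace ℝ (Fin 4) → ℝ) ∧
          tsupport (v : EuclideanSpace ℝ (Fin 4) → ℝ) ⊆ {y | 0 < y 0} ∧ 0 < ε ∧
          (∀ β, β₅ ≤ β → 1 ≤ c β 0 ∧ ∀ j : Fin 4, (|((c β j : ℤ) : ℝ)| + (b β : ℝ) + 3) * a β ≤ Λ₅) ∧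
          (∀ β, β₅ ≤ β → ∀ x : Fin 4 → ℤ, v (a β • siteToE x) ≠ 0 →
            x ∈ cubeSites (c β) (b β) ∧ 2 ≤ depth (c β) (b β) x) ∧
          (∀ β, β₅ ≤ β → ∀ ζ,
            |kerE (Matrix.specialUnitaryGroup (Fin 2) ℂ) (fundamentalLatticeRep 2) β (c β) (b β) ζ
                (fun V => ∑ x ∈ cubeSites (c β) (b β), v (a β • siteToE x) *
                  ∑ q : {q : Fin 4 × Fin 4 // q.1 < q.2},
                    plane (Matrix.specialUnitaryGroup (Fin 2) ℂ) (fundamentalLatticeRep 2) q.1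
                      (if q.1.1 = 0 then x - Pi.single 0 1 else x) V) -
              kerE (Matrix.specialUnitaryGroup (Fin 2) ℂ) (fundamentalLatticeRep 2) β (c β) (b β) ζ
                (fun V => ∑ y ∈ cubeSites (c β) (b β), v (a β • siteToE y) *
                  dens (Matrix.specialUnitaryGroup (Fin 2) ℂ) (fundamentalLatticeRep 2) y V) -
              p' β| ≤ Real.sqrt ε / 2) ∧
          (∀ β, β₅ ≤ β → ∀ L : ℕ, Λ₅ ≤ a β * L →
            4 * ε ≤ torusE (Matrix.specialUnitaryGroup (Fin 2) ℂ) (fundamentalLatticeRep 2) β L (fun V =>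
                (∑ y ∈ cubeSites (c β) (b β), v (a β • siteToE y) *
                    dens (Matrix.specialUnitaryGroup (Fin 2) ℂ) (fundamentalLatticeRep 2) y (cfgReflect V)) *
                  ∑ y ∈ cubeSites (c β) (b β), v (a β • siteToE y) *
                    dens (Matrix.specialUnitaryGroup (Fin 2) ℂ) (fundamentalLatticeRep 2) y V) -
              torusE (Matrix.specialUnitaryGroup (Fin 2) ℂ) (fundamentalLatticeRep 2) β L (fun V =>
                  ∑ y ∈ cubeSites (c β) (b β), v (a β • siteToE y) *
                    dens (Matrix.specialUnitaryGroup (Fin 2) ℂ) (fundamentalLatticeRep 2) y (cfgReflect V)) *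
                torusE (Matrix.specialUnitaryGroup (Fin 2) ℂ) (fundamentalLatticeRep 2) β L (fun V =>
                  ∑ y ∈ cubeSites (c β) (b β), v (a β • siteToE y) *
                    dens (Matrix.specialUnitaryGroup (Fin 2) ℂ) (fundamentalLatticeRep 2) y V))) ∧
      (∃ (f g h : 𝓢(EuclideanSpace ℝ (Fin 4), ℝ)) (ε β₅ Λ₅ : ℝ),
        HasCompactSupport (f : EuclideanSpace ℝ (Fin 4) → ℝ) ∧
        HasCompactSupport (g : EuclideanSpace ℝ (Fin 4) → ℝ) ∧
        HasCompactSupport (h : EuclideanSpace ℝ (Fin 4) → ℝ) ∧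
        Disjoint (tsupport (f : EuclideanSpace ℝ (Fin 4) → ℝ)) (tsupport (g : EuclideanSpace ℝ (Fin 4) → ℝ)) ∧
        Disjoint (tsupport (g : EuclideanSpace ℝ (Fin 4) → ℝ)) (tsupport (h : EuclideanSpace ℝ (Fin 4) → ℝ)) ∧
        Disjoint (tsupport (f : EuclideanSpace ℝ (Fin 4) → ℝ)) (tsupport (h : EuclideanSpace ℝ (Fin 4) → ℝ)) ∧
        0 < ε ∧ ∀ β : ℝ, β₅ ≤ β → ∀ L : ℕ, Λ₅ ≤ a β * L →
          ε ≤ |Q3 (Matrix.specialUnitaryGroup (Fin 2) ℂ) (fundamentalLatticeRep 2) β L (a β) f g h|)) :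
    letI : MeasurableSpace (Matrix.specialUnitaryGroup (Fin 2) ℂ) := borel _
    haveI : BorelSpace (Matrix.specialUnitaryGroup (Fin 2) ℂ) := ⟨rfl⟩
    ∃ (a : ℝ → ℝ) (c₀ : ℝ), 0 < c₀ ∧ (∀ β, 0 < a β) ∧
      Tendsto (fun β => a β / Transport.uRec β) atTop (𝓝 c₀) ∧
      (∃ (v : 𝓢(EuclideanSpace ℝ (Fin 4), ℝ)) (ε β₅ Λ₅ : ℝ),
        HasCompactSupport (v : EuclideanSpace ℝ (Fin 4) → ℝ) ∧
        tsupport (v : EuclideanSpace ℝ (Fin 4) → ℝ) ⊆ {y : EuclideanSpace ℝ (Fin 4) | 0 < y 0} ∧ 0 < ε ∧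
        ∀ β : ℝ, β₅ ≤ β → ∀ L : ℕ, Λ₅ ≤ a β * L →
          ε ≤ Q2 (Matrix.specialUnitaryGroup (Fin 2) ℂ) (fundamentalLatticeRep 2) β L (a β) (thetaTest 4 v) v) ∧
      (∃ (f g h : 𝓢(EuclideanSpace ℝ (Fin 4), ℝ)) (ε β₅ Λ₅ : ℝ),
        HasCompactSupport (f : EuclideanSpace ℝ (Fin 4) → ℝ) ∧
        HasCompactSupport (g : EuclideanSpace ℝ (Fin 4) → ℝ) ∧
        HasCompactSupport (h : EuclideanSpace ℝ (Fin 4) → ℝ) ∧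
        Disjoint (tsupport (f : EuclideanSpace ℝ (Fin 4) → ℝ)) (tsupport (g : EuclideanSpace ℝ (Fin 4) → ℝ)) ∧
        Disjoint (tsupport (g : EuclideanSpace ℝ (Fin 4) → ℝ)) (tsupport (h : EuclideanSpace ℝ (Fin 4) → ℝ)) ∧
        Disjoint (tsupport (f : EuclideanSpace ℝ (Fin 4) → ℝ)) (tsupport (h : EuclideanSpace ℝ (Fin 4) → ℝ)) ∧
        0 < ε ∧ ∀ β : ℝ, β₅ ≤ β → ∀ L : ℕ, Λ₅ ≤ a β * L →
          ε ≤ |Q3 (Matrix.specialUnitaryGroup (Fin 2) ℂ) (fundamentalLatticeRep 2) β L (a β) f g h|) := by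
  letI : MeasurableSpace (Matrix.specialUnitaryGroup (Fin 2) ℂ) := borel _
  haveI : BorelSpace (Matrix.specialUnitaryGroup (Fin 2) ℂ) := ⟨rfl⟩
  obtain ⟨a, c₀, hc₀, ha₀, hau, ⟨v, ε, β₅, Λ₅, c, b, p', hvK, hv, hε, hgeom, hsupp, hΔ, hMF⟩, h3⟩ := h
  exact ⟨a, c₀, hc₀, ha₀, hau,
    floorsTwoPoint_of_bareFloor_chiral (Matrix.specialUnitaryGroup (Fin 2) ℂ) (fundamentalLatticeRep 2) a ha₀ v
      hvK hv hε c b p' hgeom hsupp hΔ hMF, h3⟩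

/-- **CHECK-LEMMA (BL6 form): the REGISTERED v4-F `stub_floorsEngine` statement from {BL6, MF} at `rF`** — the
hypothesis of p512282 `stubFloorsEngine_of_mirrorPackage_rF` with its shell data `(p, 𝒢)`, (RBL+SUP) and (SF)
replaced by the single bare mirror floor (MF) on the same cube family (module docstring).  Mechanism:
`defect_response_eventually_le` ((RBLΔ) from (BL6), `O(aβ)`) + `Q2_floor_of_bareFloor_chiral` (canonical shell data
+ the chiral mirror floor). [folklore] -/
theorem stubFloorsEngine_of_bareFloor_rF
    (h : letI : MeasurableSpace (Matrix.specialUnitaryGroup (Fin 2) ℂ) := borel _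
      haveI : BorelSpace (Matrix.specialUnitaryGroup (Fin 2) ℂ) := ⟨rfl⟩
      ∃ (a : ℝ → ℝ) (c₀ : ℝ), 0 < c₀ ∧ (∀ β, 0 < a β) ∧
        Tendsto (fun β => a β / Transport.uRec β) atTop (𝓝 c₀) ∧
      (∃ (v : 𝓢(EuclideanSpace ℝ (Fin 4), ℝ)) (ε β₅ Λ₅ κ C₁ : ℝ) (c : ℝ → (Fin 4 → ℤ)) (b : ℝ → ℕ)
          (p6 : ℝ → {q : Fin 4 × Fin 4 // q.1 < q.2} → ℝ),
          HasCompactSupport (v : EuclideanSpace ℝ (Fin 4) → ℝ) ∧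
          tsupport (v : EuclideanSpace ℝ (Fin 4) → ℝ) ⊆ {y | 0 < y 0} ∧ 0 < ε ∧ 0 < κ ∧ 0 ≤ C₁ ∧
          (∀ β, β₅ ≤ β → 1 ≤ c β 0 ∧ ∀ j : Fin 4, (|((c β j : ℤ) : ℝ)| + (b β : ℝ) + 3) * a β ≤ Λ₅) ∧
          (∀ β, β₅ ≤ β → ∀ x : Fin 4 → ℤ, v (a β • siteToE x) ≠ 0 →
            x ∈ cubeSites (c β) (b β) ∧ 2 ≤ depth (c β) (b β) x) ∧
          (∀ β, β₅ ≤ β → ∀ x : Fin 4 → ℤ,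
            (v (a β • siteToE x) ≠ 0 ∨ v (a β • siteToE (x + Pi.single 0 1)) ≠ 0) →
              x ∈ cubeSites (c β) (b β) ∧ κ / a β ≤ (depth (c β) (b β) x : ℝ)) ∧
          (∀ β, β₅ ≤ β → ∀ (ζ : LGConfig 4 (Matrix.specialUnitaryGroup (Fin 2) ℂ))
            (q : {q : Fin 4 × Fin 4 // q.1 < q.2}), q.1.1 = 0 → ∀ x ∈ cubeSites (c β) (b β),
              (v (a β • siteToE x) ≠ 0 ∨ v (a β • siteToE (x + Pi.single 0 1)) ≠ 0) →
                |kerE (Matrix.specialUnitaryGroup (Fin 2) ℂ) (fundamentalLatticeRep 2) β (c β) (b β) ζ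
                    (plane (Matrix.specialUnitaryGroup (Fin 2) ℂ) (fundamentalLatticeRep 2) q.1 x) - p6 β q| ≤
                  C₁ / (depth (c β) (b β) x : ℝ) ^ 4) ∧
          (∀ β, β₅ ≤ β → ∀ L : ℕ, Λ₅ ≤ a β * L →
            4 * ε ≤ torusE (Matrix.specialUnitaryGroup (Fin 2) ℂ) (fundamentalLatticeRep 2) β L (fun V =>
                (∑ y ∈ cubeSites (c β) (b β), v (a β • siteToE y) *
                    dens (Matrix.specialUnitaryGroup (Fin 2) ℂ) (fundamentalLatticeRep 2) y (cfgReflect V)) *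
                  ∑ y ∈ cubeSites (c β) (b β), v (a β • siteToE y) *
                    dens (Matrix.specialUnitaryGroup (Fin 2) ℂ) (fundamentalLatticeRep 2) y V) -
              torusE (Matrix.specialUnitaryGroup (Fin 2) ℂ) (fundamentalLatticeRep 2) β L (fun V =>
                  ∑ y ∈ cubeSites (c β) (b β), v (a β • siteToE y) *
                    dens (Matrix.specialUnitaryGroup (Fin 2) ℂ) (fundamentalLatticeRep 2) y (cfgReflect V)) *
                torusE (Matrix.specialUnitaryGroup (Fin 2) ℂ) (fundamentalLatticeRep 2) β L (fun V =>
                  ∑ y ∈ cubeSites (c β) (b β), v (a β • siteToE y) *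
                    dens (Matrix.specialUnitaryGroup (Fin 2) ℂ) (fundamentalLatticeRep 2) y V))) ∧
      (∃ (f g h : 𝓢(EuclideanSpace ℝ (Fin 4), ℝ)) (ε β₅ Λ₅ : ℝ),
        HasCompactSupport (f : EuclideanSpace ℝ (Fin 4) → ℝ) ∧
        HasCompactSupport (g : EuclideanSpace ℝ (Fin 4) → ℝ) ∧
        HasCompactSupport (h : EuclideanSpace ℝ (Fin 4) → ℝ) ∧
        Disjoint (tsupport (f : EuclideanSpace ℝ (Fin 4) → ℝ)) (tsupport (g : EuclideanSpace ℝ (Fin 4) → ℝ)) ∧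
        Disjoint (tsupport (g : EuclideanSpace ℝ (Fin 4) → ℝ)) (tsupport (h : EuclideanSpace ℝ (Fin 4) → ℝ)) ∧
        Disjoint (tsupport (f : EuclideanSpace ℝ (Fin 4) → ℝ)) (tsupport (h : EuclideanSpace ℝ (Fin 4) → ℝ)) ∧
        0 < ε ∧ ∀ β : ℝ, β₅ ≤ β → ∀ L : ℕ, Λ₅ ≤ a β * L →
          ε ≤ |Q3 (Matrix.specialUnitaryGroup (Fin 2) ℂ) (fundamentalLatticeRep 2) β L (a β) f g h|)) :
    letI : MeasurableSpace (Matrix.specialUnitaryGroup (Fin 2) ℂ) := borel _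
    haveI : BorelSpace (Matrix.specialUnitaryGroup (Fin 2) ℂ) := ⟨rfl⟩
    ∃ (a : ℝ → ℝ) (c₀ : ℝ), 0 < c₀ ∧ (∀ β, 0 < a β) ∧
      Tendsto (fun β => a β / Transport.uRec β) atTop (𝓝 c₀) ∧
      (∃ (v : 𝓢(EuclideanSpace ℝ (Fin 4), ℝ)) (ε β₅ Λ₅ : ℝ),
        HasCompactSupport (v : EuclideanSpace ℝ (Fin 4) → ℝ) ∧
        tsupport (v : EuclideanSpace ℝ (Fin 4) → ℝ) ⊆ {y : EuclideanSpace ℝ (Fin 4) | 0 < y 0} ∧ 0 < ε ∧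
        ∀ β : ℝ, β₅ ≤ β → ∀ L : ℕ, Λ₅ ≤ a β * L →
          ε ≤ Q2 (Matrix.specialUnitaryGroup (Fin 2) ℂ) (fundamentalLatticeRep 2) β L (a β) (thetaTest 4 v) v) ∧
      (∃ (f g h : 𝓢(EuclideanSpace ℝ (Fin 4), ℝ)) (ε β₅ Λ₅ : ℝ),
        HasCompactSupport (f : EuclideanSpace ℝ (Fin 4) → ℝ) ∧
        HasCompactSupport (g : EuclideanSpace ℝ (Fin 4) → ℝ) ∧
        HasCompactSupport (h : EuclideanSpace ℝ (Fin 4) → ℝ) ∧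
        Disjoint (tsupport (f : EuclideanSpace ℝ (Fin 4) → ℝ)) (tsupport (g : EuclideanSpace ℝ (Fin 4) → ℝ)) ∧
        Disjoint (tsupport (g : EuclideanSpace ℝ (Fin 4) → ℝ)) (tsupport (h : EuclideanSpace ℝ (Fin 4) → ℝ)) ∧
        Disjoint (tsupport (f : EuclideanSpace ℝ (Fin 4) → ℝ)) (tsupport (h : EuclideanSpace ℝ (Fin 4) → ℝ)) ∧
        0 < ε ∧ ∀ β : ℝ, β₅ ≤ β → ∀ L : ℕ, Λ₅ ≤ a β * L →
          ε ≤ |Q3 (Matrix.specialUnitaryGroup (Fin 2) ℂ) (fundamentalLatticeRep 2) β L (a β) f g h|) := by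
  letI : MeasurableSpace (Matrix.specialUnitaryGroup (Fin 2) ℂ) := borel _
  haveI : BorelSpace (Matrix.specialUnitaryGroup (Fin 2) ℂ) := ⟨rfl⟩
  obtain ⟨a, c₀, hc₀, ha₀, hau, ⟨v, ε, β₅, Λ₅, κ, C₁, c, b, p6, hvK, hv, hε, hκ, hC₁, hgeom, hsupp, hthick, hBL,
    hMF⟩, h3⟩ := h
  have ha : Tendsto a atTop (𝓝 0) := ReferenceFloors.tendsto_zero_of_ratio hau
  -- (RBLΔ) from the boundary law, eventually
  have hη : 0 < Real.sqrt ε / 2 := by positivity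
  obtain ⟨β₆, hΔ⟩ := defect_response_eventually_le (Matrix.specialUnitaryGroup (Fin 2) ℂ) (fundamentalLatticeRep 2)
    a ha₀ ha v hvK hκ hC₁ c b p6 hsupp hthick hBL hη
  -- the two-point floor for the SAME `v`, from {RBLΔ, MF} restricted to `β ≥ max β₅ β₆`
  have key := Q2_floor_of_bareFloor_chiral (Matrix.specialUnitaryGroup (Fin 2) ℂ) (fundamentalLatticeRep 2) a ha₀ v
    hε (β₅ := max β₅ β₆) (Λ₅ := Λ₅) c b
    (fun β => ∑ x ∈ cubeSites (c β) (b β), (v (a β • siteToE (x + Pi.single 0 1)) - v (a β • siteToE x)) *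
      ∑ q : {q : Fin 4 × Fin 4 // q.1 < q.2}, (if q.1.1 = 0 then p6 β q else 0))
    (fun β hβ => hgeom β (le_trans (le_max_left _ _) hβ))
    (fun β hβ => hsupp β (le_trans (le_max_left _ _) hβ))
    (fun β hβ ζ => hΔ β (le_trans (le_max_right _ _) hβ) ζ)
    (fun β hβ => hMF β (le_trans (le_max_left _ _) hβ))
  exact ⟨a, c₀, hc₀, ha₀, hau, ⟨v, ε, max (max β₅ β₆) 0, Λ₅, hvK, hv, hε, key⟩, h3⟩

end Summit.QuantumFields.YangMills.Cruxes.UVSeamRec.MarkovMirrorFloors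

end
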